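import Literature.AlgebraicGeometry.Frobenioids.BaseMorphismFactorisation
import HarnessLib

/-!
# Frobenioids I, proof of Theorem 3.4 (v): the transport of base morphisms `Base(A) → Base(A')` along `Ψ`
# and the functor `Ψ^Base` with its `1`-commutative square

Mochizuki, *The geometry of Frobenioids I: the general theory*, Kyushu J. Math. **62** (2008)
293–400, Thm. 3.4 (v) p. 63 ll. 25–36 and its proof p. 68 l. 22 – p. 69 l. 20
[cite: MochizukiFrdI2008, Thm. 3.4 (v) p.63]:

> "… there exists a 1-unique functor `Ψ^Base : D_1 → D_2` that fits into a 1-commutative diagram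
> [`C_i → D_i` the natural projections] … any morphism `φ_D : A_D → A'_D` may be written in the form
> `φ_D = Base(ψ) ∘ Base(γ) ∘ Base(α)⁻¹` … it follows that we obtain an equivalence of categories
> `Ψ^Q : Q_1 ⥲ Q_2` that is 1-compatible with `Ψ` …"

Construction file (seat abc-iut-L1-d4 gen 2; sub-node FrdI:Thm3.4(v)/L13 `PsiBaseFunctor` of
plan/L1/SUBDAG-FrdI-Thm34.md). ROUTE (the print's presentation of the arrows of `D_i` by "roofs"
`Base(δ) ∘ Base(α)⁻¹`, made functorial directly instead of through the 2-categories `Q_i`): for objects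
`A, A'` of `C₁` and `h : Base(A) → Base(A')`, a ROOF of `h` is `(B, α : B → A, δ : B → A')` with `Base(α)`
and `Base(Ψα)` invertible and `Base(α) ≫ h = Base(δ)` (roofs exist by Def. 1.3 (i)(b)(c),
`exists_base_factorisation`); its value `Base(Ψα)⁻¹ ≫ Base(Ψδ)` does not depend on the roof as soon as
`Ψ` PRESERVES BASE-EQUIVALENT PAIRS (the first sentence of Thm. 3.4 (v) = sub-node L12, a NAMED HYPOTHESIS
`hbe` here) and carries pre-steps to base-isomorphisms (Thm. 3.4 (iii), hypothesis `hbi`): two roofs are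
dominated by a third through Def. 1.3 (i)(b). This gives `transportBase Ψ h : Base(ΨA) → Base(ΨA')` with
`transportBase (Base φ) = Base(Ψφ)`, `transportBase (𝟙) = 𝟙`, `transportBase (h ≫ k) = … ≫ …`; choosing
lifts of the objects of `D₁` (Def. 1.3 (i)(a)) then yields the functor `psiBase : D₁ ⥤ D₂` and the natural
isomorphism `psiBaseSquare : Base₂ ∘ Ψ ≅ psiBase ∘ Base₁`. (Equivalence and `1`-uniqueness of `Ψ^Base`,
rigidity: not in this file.) Nothing of [FrdI] is restated; `hbe`/`hbi` are inputs by name.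
-/

namespace Literature.AlgebraicGeometry.Frobenioids

open CategoryTheory Opposite

universe w v v' u u'

namespace PreFrobenioid

variable {D₁ : Type u} [Category.{v} D₁] {Φ₁ : D₁ᵒᵖ ⥤ CommMonCat.{w}} {C₁ : Type u'} [Category.{v'} C₁]
  {D₂ : Type u} [Category.{v} D₂] {Φ₂ : D₂ᵒᵖ ⥤ CommMonCat.{w}} {C₂ : Type u'} [Category.{v'} C₂]
  {F₁ : C₁ ⥤ ElemFrobenioid Φ₁} {F₂ : C₂ ⥤ ElemFrobenioid Φ₂}

/-! ### Roofs of a base morphism and their values -/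

variable (F₁ F₂) in
/-- A ROOF of a base morphism `h : Base(A) → Base(A')` with respect to `Ψ`: `α : B → A`, `δ : B → A'`
with `Base(α)`, `Base(Ψα)` invertible and `Base(α) ≫ h = Base(δ)` ("`φ_D = Base(ψ) ∘ Base(γ) ∘ Base(α)⁻¹`",
p. 68, with `δ = ψ ∘ γ`). [cite: MochizukiFrdI2008, Thm. 3.4 (v) p.68] -/
structure BaseRoof (Ψ : C₁ ⥤ C₂) {A A' : C₁} (h : baseObj F₁ A ⟶ baseObj F₁ A') where
  /-- the apex -/
  apex : C₁
  /-- the left leg (a base-isomorphism) -/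
  α : apex ⟶ A
  /-- the right leg -/
  δ : apex ⟶ A'
  /-- `Base(α)` is invertible -/
  isIso_base : IsIso (Base F₁ α)
  /-- `Base(Ψα)` is invertible -/
  isIso_map : IsIso (Base F₂ (Ψ.map α))
  /-- `Base(α) ≫ h = Base(δ)` -/
  comm : Base F₁ α ≫ h = Base F₁ δ

namespace BaseRoof

variable {Ψ : C₁ ⥤ C₂} {A A' : C₁} {h : baseObj F₁ A ⟶ baseObj F₁ A'}

/-- The VALUE `Base(Ψα)⁻¹ ≫ Base(Ψδ) : Base(ΨA) → Base(ΨA')` of a roof. [cite: MochizukiFrdI2008, Thm. 3.4 (v) p.68] -/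
noncomputable def val (r : BaseRoof F₁ F₂ Ψ h) : baseObj F₂ (Ψ.obj A) ⟶ baseObj F₂ (Ψ.obj A') :=
  haveI := r.isIso_map
  inv (Base F₂ (Ψ.map r.α)) ≫ Base F₂ (Ψ.map r.δ)

/-- `Base(Ψα) ≫ val = Base(Ψδ)`. [cite: MochizukiFrdI2008, Thm. 3.4 (v) p.68] -/
theorem base_comp_val (r : BaseRoof F₁ F₂ Ψ h) : Base F₂ (Ψ.map r.α) ≫ r.val = Base F₂ (Ψ.map r.δ) := by
  haveI := r.isIso_map
  unfold val
  rw [IsIso.hom_inv_id_assoc]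

end BaseRoof

/-- Roofs exist in a Frobenioid (Def. 1.3 (i)(b)(c): `exists_base_factorisation`), given that `Ψ` carries
pre-steps to morphisms with invertible base (Thm. 3.4 (iii)). [cite: MochizukiFrdI2008, Thm. 3.4 (v) p.68] -/
theorem nonempty_baseRoof (hF₁ : IsFrobenioid F₁) (Ψ : C₁ ⥤ C₂)
    (hbi : ∀ ⦃B A : C₁⦄ (α : B ⟶ A), IsPreStep F₁ α → IsIso (Base F₂ (Ψ.map α)))
    {A A' : C₁} (h : baseObj F₁ A ⟶ baseObj F₁ A') : Nonempty (BaseRoof F₁ F₂ Ψ h) := by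
  obtain ⟨B, X, α, γ, ψ, hα, -, -, hcomm⟩ := exists_base_factorisation hF₁ h
  exact ⟨⟨B, α, γ ≫ ψ, hα.2, hbi α hα, by rw [hcomm, base_comp]⟩⟩

/-- **Independence of the roof** (the heart of the construction of `Ψ^Base`): if `Ψ` preserves
base-equivalent pairs (Thm. 3.4 (v), first sentence — hypothesis `hbe`) and carries pre-steps to
morphisms with invertible base (`hbi`), two roofs of the same base morphism have the same value: by
Def. 1.3 (i)(b) the base-isomorphism `Base(α) ≫ Base(α')⁻¹` is `Base(ν) ∘ Base(μ)⁻¹` for pre-steps `μ, ν`,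
and then `(μ ≫ α, ν ≫ α')`, `(μ ≫ δ, ν ≫ δ')` are base-equivalent pairs. [cite: MochizukiFrdI2008, Thm. 3.4 (v) p.68] -/
theorem BaseRoof.val_eq_val (hF₁ : IsFrobenioid F₁) {Ψ : C₁ ⥤ C₂}
    (hbi : ∀ ⦃B A : C₁⦄ (α : B ⟶ A), IsPreStep F₁ α → IsIso (Base F₂ (Ψ.map α)))
    (hbe : ∀ ⦃A B : C₁⦄ (φ ψ : A ⟶ B), BaseEquivalent F₁ φ ψ → BaseEquivalent F₂ (Ψ.map φ) (Ψ.map ψ))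
    {A A' : C₁} {h : baseObj F₁ A ⟶ baseObj F₁ A'} (r r' : BaseRoof F₁ F₂ Ψ h) : r.val = r'.val := by
  haveI := r.isIso_base
  haveI := r'.isIso_base
  haveI := r.isIso_map
  haveI := r'.isIso_map
  -- dominate the two apices through Def. 1.3 (i)(b)
  let e : baseObj F₁ r.apex ≅ baseObj F₁ r'.apex := asIso (Base F₁ r.α) ≪≫ (asIso (Base F₁ r'.α)).symm
  obtain ⟨X, μ, ν, hμ, -, hμν⟩ := hF₁.i_b r.apex r'.apex e
  have he : e.hom = Base F₁ r.α ≫ inv (Base F₁ r'.α) := rfl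
  -- the two base-equivalent pairs
  have h1 : BaseEquivalent F₁ (μ ≫ r.α) (ν ≫ r'.α) := by
    unfold BaseEquivalent
    rw [base_comp, base_comp, ← hμν, he, Category.assoc, Category.assoc, IsIso.inv_hom_id, Category.comp_id]
  have h2 : BaseEquivalent F₁ (μ ≫ r.δ) (ν ≫ r'.δ) := by
    unfold BaseEquivalent
    rw [base_comp, base_comp, ← r.comm, ← r'.comm, ← hμν, he]
    simp only [Category.assoc, IsIso.inv_hom_id_assoc]
  have h1' := hbe _ _ h1
  have h2' := hbe _ _ h2
  unfold BaseEquivalent at h1' h2'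
  rw [Ψ.map_comp, Ψ.map_comp, base_comp, base_comp] at h1' h2'
  -- cancel the isomorphism `Base(Ψ(μ ≫ α))`
  haveI : IsIso (Base F₂ (Ψ.map μ)) := hbi μ hμ
  rw [← cancel_epi (Base F₂ (Ψ.map μ) ≫ Base F₂ (Ψ.map r.α)), Category.assoc, r.base_comp_val, h1',
    Category.assoc, r'.base_comp_val, h2']

/-! ### The transport of base morphisms -/

/-- **The transport `h ↦ Ψ^Base(h)`** of a base morphism `h : Base(A) → Base(A')` along `Ψ`: the value of
any roof of `h`. [cite: MochizukiFrdI2008, Thm. 3.4 (v) p.68] -/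
noncomputable def transportBase (hF₁ : IsFrobenioid F₁) (Ψ : C₁ ⥤ C₂)
    (hbi : ∀ ⦃B A : C₁⦄ (α : B ⟶ A), IsPreStep F₁ α → IsIso (Base F₂ (Ψ.map α)))
    {A A' : C₁} (h : baseObj F₁ A ⟶ baseObj F₁ A') : baseObj F₂ (Ψ.obj A) ⟶ baseObj F₂ (Ψ.obj A') :=
  (Classical.choice (nonempty_baseRoof hF₁ Ψ hbi h)).val

section Transport

variable (hF₁ : IsFrobenioid F₁) (Ψ : C₁ ⥤ C₂)
  (hbi : ∀ ⦃B A : C₁⦄ (α : B ⟶ A), IsPreStep F₁ α → IsIso (Base F₂ (Ψ.map α)))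
  (hbe : ∀ ⦃A B : C₁⦄ (φ ψ : A ⟶ B), BaseEquivalent F₁ φ ψ → BaseEquivalent F₂ (Ψ.map φ) (Ψ.map ψ))

include hbe in
/-- The transport is computed by ANY roof. [cite: MochizukiFrdI2008, Thm. 3.4 (v) p.68] -/
theorem transportBase_eq_val {A A' : C₁} {h : baseObj F₁ A ⟶ baseObj F₁ A'} (r : BaseRoof F₁ F₂ Ψ h) :
    transportBase hF₁ Ψ hbi h = r.val :=
  BaseRoof.val_eq_val hF₁ hbi hbe _ r

include hbe in
/-- **Compatibility with `Base`**: `Ψ^Base(Base φ) = Base(Ψ φ)` (the roof `(A, 𝟙, φ)`).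
[cite: MochizukiFrdI2008, Thm. 3.4 (v) p.68] -/
theorem transportBase_base {A A' : C₁} (φ : A ⟶ A') :
    transportBase hF₁ Ψ hbi (Base F₁ φ) = Base F₂ (Ψ.map φ) := by
  have hi1 : IsIso (Base F₁ (𝟙 A)) := by rw [base_id]; infer_instance
  have hi2 : IsIso (Base F₂ (Ψ.map (𝟙 A))) := by rw [Ψ.map_id, base_id]; infer_instance
  let R : BaseRoof F₁ F₂ Ψ (Base F₁ φ) := ⟨A, 𝟙 A, φ, hi1, hi2, by rw [base_id, Category.id_comp]⟩
  have h := R.base_comp_val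
  change Base F₂ (Ψ.map (𝟙 A)) ≫ R.val = Base F₂ (Ψ.map φ) at h
  rw [Ψ.map_id, base_id, Category.id_comp] at h
  rw [transportBase_eq_val hF₁ Ψ hbi hbe R]
  exact h

include hbe in
/-- `Ψ^Base(𝟙) = 𝟙`. [cite: MochizukiFrdI2008, Thm. 3.4 (v) p.68] -/
theorem transportBase_id (A : C₁) : transportBase hF₁ Ψ hbi (𝟙 (baseObj F₁ A)) = 𝟙 _ := by
  rw [← base_id F₁ A, transportBase_base hF₁ Ψ hbi hbe, Ψ.map_id, base_id]

include hbe in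
/-- **Functoriality**: `Ψ^Base(h ≫ k) = Ψ^Base(h) ≫ Ψ^Base(k)` — compose roofs by factorising the middle
base morphism `Base(δ) ≫ Base(α')⁻¹` once more (Def. 1.3 (i)(b)(c)) and use a base-equivalent pair.
[cite: MochizukiFrdI2008, Thm. 3.4 (v) p.68] -/
theorem transportBase_comp {A A' A'' : C₁} (h : baseObj F₁ A ⟶ baseObj F₁ A') (k : baseObj F₁ A' ⟶ baseObj F₁ A'') :
    transportBase hF₁ Ψ hbi (h ≫ k) = transportBase hF₁ Ψ hbi h ≫ transportBase hF₁ Ψ hbi k := by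
  obtain ⟨r⟩ := nonempty_baseRoof hF₁ Ψ hbi h
  obtain ⟨r'⟩ := nonempty_baseRoof hF₁ Ψ hbi k
  haveI := r.isIso_base
  haveI := r'.isIso_base
  haveI := r.isIso_map
  haveI := r'.isIso_map
  -- factorise the middle morphism `Base(δ) ≫ Base(α')⁻¹ : Base(B) → Base(B')`
  obtain ⟨B₃, X, α₃, γ₃, ψ₃, hα₃, -, -, hm⟩ :=
    exists_base_factorisation hF₁ (Base F₁ r.δ ≫ inv (Base F₁ r'.α) : baseObj F₁ r.apex ⟶ baseObj F₁ r'.apex)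
  haveI : IsIso (Base F₁ α₃) := hα₃.2
  haveI : IsIso (Base F₂ (Ψ.map α₃)) := hbi α₃ hα₃
  -- the composite roof of `h ≫ k`
  have hk : inv (Base F₁ r'.α) ≫ Base F₁ r'.δ = k := by
    rw [IsIso.inv_comp_eq]
    exact r'.comm.symm
  have hm' : Base F₁ γ₃ ≫ Base F₁ ψ₃ = Base F₁ α₃ ≫ Base F₁ r.δ ≫ inv (Base F₁ r'.α) := hm.symm
  have hcomm : Base F₁ (α₃ ≫ r.α) ≫ (h ≫ k) = Base F₁ ((γ₃ ≫ ψ₃) ≫ r'.δ) := by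
    simp only [base_comp, Category.assoc]
    rw [reassoc_of% r.comm, reassoc_of% hm', hk]
  have hI1 : IsIso (Base F₁ (α₃ ≫ r.α)) := by rw [base_comp]; infer_instance
  have hI2 : IsIso (Base F₂ (Ψ.map (α₃ ≫ r.α))) := by rw [Ψ.map_comp, base_comp]; infer_instance
  let R : BaseRoof F₁ F₂ Ψ (h ≫ k) := ⟨B₃, α₃ ≫ r.α, (γ₃ ≫ ψ₃) ≫ r'.δ, hI1, hI2, hcomm⟩
  rw [transportBase_eq_val hF₁ Ψ hbi hbe R, transportBase_eq_val hF₁ Ψ hbi hbe r,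
    transportBase_eq_val hF₁ Ψ hbi hbe r']
  -- the base-equivalent pair `(α₃ ≫ δ, (γ₃ ≫ ψ₃) ≫ α')`
  have hpair : BaseEquivalent F₁ (α₃ ≫ r.δ) ((γ₃ ≫ ψ₃) ≫ r'.α) := by
    unfold BaseEquivalent
    simp only [base_comp, Category.assoc]
    rw [reassoc_of% hm']
    simp only [IsIso.inv_hom_id, Category.comp_id]
  have hp : Base F₂ (Ψ.map α₃) ≫ Base F₂ (Ψ.map r.δ) =
      Base F₂ (Ψ.map γ₃) ≫ Base F₂ (Ψ.map ψ₃) ≫ Base F₂ (Ψ.map r'.α) := by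
    have := hbe _ _ hpair
    simp only [BaseEquivalent, Ψ.map_comp, base_comp, Category.assoc] at this
    exact this
  haveI := R.isIso_map
  rw [← cancel_epi (Base F₂ (Ψ.map R.α)), R.base_comp_val]
  change Base F₂ (Ψ.map ((γ₃ ≫ ψ₃) ≫ r'.δ)) = Base F₂ (Ψ.map (α₃ ≫ r.α)) ≫ r.val ≫ r'.val
  simp only [Ψ.map_comp, base_comp, Category.assoc]
  rw [reassoc_of% r.base_comp_val, reassoc_of% hp, r'.base_comp_val]

end Transport

/-! ### The functor `Ψ^Base` and its square -/

section PsiBase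

variable (hF₁ : IsFrobenioid F₁) (Ψ : C₁ ⥤ C₂)
  (hbi : ∀ ⦃B A : C₁⦄ (α : B ⟶ A), IsPreStep F₁ α → IsIso (Base F₂ (Ψ.map α)))
  (hbe : ∀ ⦃A B : C₁⦄ (φ ψ : A ⟶ B), BaseEquivalent F₁ φ ψ → BaseEquivalent F₂ (Ψ.map φ) (Ψ.map ψ))

/-- A chosen lift `A_X ∈ Ob(C₁)` of an object `X` of `D₁` (Def. 1.3 (i)(a)). [cite: MochizukiFrdI2008, Def. 1.3 (i) p.24] -/
noncomputable def liftObj (X : D₁) : C₁ := (hF₁.i_a X).choose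

/-- The base-isomorphism `Base(A_X) ≅ X` of the chosen lift. [cite: MochizukiFrdI2008, Def. 1.3 (i) p.24] -/
noncomputable def liftObjIso (X : D₁) : baseObj F₁ (liftObj hF₁ X) ≅ X :=
  (hF₁.i_a X).choose_spec.2.some

/-- **`Ψ^Base : D₁ ⥤ D₂`** ([FrdI] Thm. 3.4 (v)): `X ↦ Base(Ψ A_X)`, `f ↦ Ψ^Base(ι_X ≫ f ≫ ι_Y⁻¹)` — under
the hypotheses `hbi` (Thm. 3.4 (iii)) and `hbe` (Thm. 3.4 (v), first sentence).
[cite: MochizukiFrdI2008, Thm. 3.4 (v) p.63] -/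
noncomputable def psiBase : D₁ ⥤ D₂ where
  obj X := baseObj F₂ (Ψ.obj (liftObj hF₁ X))
  map {X Y} f := transportBase hF₁ Ψ hbi ((liftObjIso hF₁ X).hom ≫ f ≫ (liftObjIso hF₁ Y).inv)
  map_id X := by
    rw [Category.id_comp, Iso.hom_inv_id, transportBase_id hF₁ Ψ hbi hbe]
  map_comp {X Y Z} f g := by
    rw [← transportBase_comp hF₁ Ψ hbi hbe]
    simp only [Category.assoc, Iso.inv_hom_id_assoc]

/-- `Ψ^Base` on objects. [cite: MochizukiFrdI2008, Thm. 3.4 (v) p.63] -/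
theorem psiBase_obj (X : D₁) : (psiBase hF₁ Ψ hbi hbe).obj X = baseObj F₂ (Ψ.obj (liftObj hF₁ X)) := rfl

/-- `Ψ^Base` on arrows. [cite: MochizukiFrdI2008, Thm. 3.4 (v) p.63] -/
theorem psiBase_map {X Y : D₁} (f : X ⟶ Y) : (psiBase hF₁ Ψ hbi hbe).map f =
    transportBase hF₁ Ψ hbi ((liftObjIso hF₁ X).hom ≫ f ≫ (liftObjIso hF₁ Y).inv) := rfl

/-- The component `Base(ΨA) ≅ Ψ^Base(Base A)` of the square: the transport of `ι_{Base A}⁻¹ : Base A →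
Base A_{Base A}`. [cite: MochizukiFrdI2008, Thm. 3.4 (v) p.63] -/
noncomputable def psiBaseSquareApp (A : C₁) :
    baseObj F₂ (Ψ.obj A) ≅ (psiBase hF₁ Ψ hbi hbe).obj (baseObj F₁ A) where
  hom := transportBase hF₁ Ψ hbi (liftObjIso hF₁ (baseObj F₁ A)).inv
  inv := transportBase hF₁ Ψ hbi (liftObjIso hF₁ (baseObj F₁ A)).hom
  hom_inv_id := by
    have h := (transportBase_comp hF₁ Ψ hbi hbe (liftObjIso hF₁ (baseObj F₁ A)).inv
      (liftObjIso hF₁ (baseObj F₁ A)).hom).symm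
    rw [Iso.inv_hom_id, transportBase_id hF₁ Ψ hbi hbe] at h
    exact h
  inv_hom_id := by
    have h := (transportBase_comp hF₁ Ψ hbi hbe (liftObjIso hF₁ (baseObj F₁ A)).hom
      (liftObjIso hF₁ (baseObj F₁ A)).inv).symm
    rw [Iso.hom_inv_id, transportBase_id hF₁ Ψ hbi hbe] at h
    exact h

/-- **The `1`-commutative square of Thm. 3.4 (v)**: `Base₂ ∘ Ψ ≅ Ψ^Base ∘ Base₁`.
[cite: MochizukiFrdI2008, Thm. 3.4 (v) p.63] -/
noncomputable def psiBaseSquare : Ψ ⋙ baseFunctor F₂ ≅ baseFunctor F₁ ⋙ psiBase hF₁ Ψ hbi hbe :=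
  NatIso.ofComponents (fun A => psiBaseSquareApp hF₁ Ψ hbi hbe A) (by
    intro A A' φ
    change Base F₂ (Ψ.map φ) ≫ transportBase hF₁ Ψ hbi (liftObjIso hF₁ (baseObj F₁ A')).inv =
      transportBase hF₁ Ψ hbi (liftObjIso hF₁ (baseObj F₁ A)).inv ≫
        transportBase hF₁ Ψ hbi ((liftObjIso hF₁ (baseObj F₁ A)).hom ≫ Base F₁ φ ≫ (liftObjIso hF₁ (baseObj F₁ A')).inv)
    have h1 := transportBase_comp hF₁ Ψ hbi hbe (Base F₁ φ) (liftObjIso hF₁ (baseObj F₁ A')).inv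
    have h2 := transportBase_comp hF₁ Ψ hbi hbe (liftObjIso hF₁ (baseObj F₁ A)).inv
      ((liftObjIso hF₁ (baseObj F₁ A)).hom ≫ Base F₁ φ ≫ (liftObjIso hF₁ (baseObj F₁ A')).inv)
    rw [Iso.inv_hom_id_assoc, h1, transportBase_base hF₁ Ψ hbi hbe] at h2
    exact h2)

end PsiBase

end PreFrobenioid

end Literature.AlgebraicGeometry.Frobenioids
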